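import Literature.NumberTheory.ComplexMultiplication.SlotwiseIndependentOfLinearlyDisjoint
import Literature.AlgebraicGeometry.ComplexMultiplication.IndependentCMFieldsHodge
import HarnessLib

/-!
# Products of CM abelian varieties whose CM fields have LINEARLY DISJOINT Galois closures: additive rank, stable
# nondegeneracy factor by factor, and the Hodge conjecture for every `∏_i A_i^{k_i}`

COR-CM (cell `pub-hodgecm2`, binder seat `b23` gen 27), count-neutral; NEW as stated, hence under `Summits/`.  The file
`Summits/HodgeConjecture/CorCM/IndependentCMFieldsHodge` proves, for CM fields `K_i` on whose complex embeddings `Aut(ℂ)`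
acts SLOTWISE INDEPENDENTLY (`SlotwiseIndependent (ℂ ≃+* ℂ) (fun i => K i →+* ℂ)`), that the rank of a family of CM
types is additive, that the family is nondegenerate iff every member is, and that every product `⨁_{j<N} A_{π j}` of
realisations of nondegenerate types has `Bᵐ ⊗ ℂ = Dᵐ ⊗ ℂ` and satisfies the Hodge conjecture; it discharges the
independence hypothesis for CYCLOTOMIC fields of pairwise coprime levels.  The literature file
`Literature.NumberTheory.ComplexMultiplication.SlotwiseIndependentOfLinearlyDisjoint` (this seat) discharges it in the
generality in which it is usually quoted — "the Galois closures of the `K_i` are linearly disjoint" — by the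
field-theoretic criterion `slotwiseIndependent_of_linearDisjoint_normalClosure` (Mathlib `IntermediateField.LinearDisjoint`
of `L_i = normalClosure ℚ K_i ℂ` from `⨆_{j≠i} L_j`; Galois form `L_i ∩ ∏_{j≠i} L_j = ℚ`; degree form
`[L_i ∏_{j≠i} L_j : ℚ] = [L_i : ℚ][∏_{j≠i} L_j : ℚ]`).  This file records the consequences BY NAME:

* `cmFamilyRank_add_card_eq_of_linearDisjoint` — `rank Hg(∏_i A_{Φ_i}) = Σ_i rank Hg(A_{Φ_i})`;
* `isNondegenerateFamily_iff_of_linearDisjoint` (and `…_of_normalClosure_inf_eq_bot`) — the family `(Φ_i)` is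
  nondegenerate iff every `Φ_i` is;
* `hodgeClassSpan_prod_eq_divisorClassesSpan_of_linearDisjoint`, `not_exists_exceptional_prod_of_linearDisjoint`,
  **`hodgeConjectureFor_prod_of_linearDisjoint`**, **`hodgeConjectureFor_prod_of_normalClosure_inf_eq_bot`**,
  `hodgeConjectureFor_prod_of_finrank_normalClosure_sup` — for NONDEGENERATE types `Φ_i` of CM fields with linearly
  disjoint Galois closures, every product `⨁_{j<N} A_{π j}` (every `∏_i A_i^{k_i}`) of realisations has `B• = D•` and
  satisfies the Hodge conjecture, UNCONDITIONALLY (no named fact): Gordon's §3 Theorem (Imai 1976 / Murty 1984: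
  pairwise non-isogenous CM elliptic curves, "since the fields are distinct …") for CM abelian varieties of any dimension
  whose fields do not interact.

* `isNondegenerateFamily_iff_of_finrank_iSup_normalClosure_eq_prod`,
  `hodgeClassSpan_prod_eq_divisorClassesSpan_of_finrank_iSup_normalClosure_eq_prod`,
  **`hodgeConjectureFor_prod_of_finrank_iSup_normalClosure_eq_prod`** (appended) — the symmetric FAMILY form of the
  hypothesis: `[∏_i L_i : ℚ] = ∏_i [L_i : ℚ]` for the Galois closures `L_i` (equivalently
  `Gal(∏_i L_i/ℚ) = ∏_i Gal(L_i/ℚ)`), via `linearDisjoint_iSup_ne_of_finrank_iSup_eq_prod`.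

Everything is a one-line application; theorems only, no definition, no `sorry`.

## References

* [Gordon1999HodgeAVSurvey] B. B. Gordon, *A survey of the Hodge conjecture for abelian varieties*, §3 Theorem (Imai,
  Murty) with proof; 7.5–7.7; 10.10.
* [Lang2002] S. Lang, *Algebra*, 3rd ed., VI §1 Thm. 1.14 (compositum of linearly disjoint Galois extensions).

Provenance: Literature home (namespace `Literature.AlgebraicGeometry.ComplexMultiplication.LinearlyDisjointCMFieldsHodge`) of the Summits-side `CorCM/LinearlyDisjointCMFieldsHodge` (cell `pub-hodgecm2`, COR-CM; all its imports are `Literature/`, Mathlib and the already re-homed `IndependentCMFieldsHodge`), which `Literature/` may not import; theorems only, no named fact, no definition. Nothing here bears on `HC_CM`. Lane `lit-hodgefound` (Layer A3: CM types, their Kubota ranks and Galois combinatorics), seat p20.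
-/

noncomputable section

open _root_.CategoryTheory _root_.CategoryTheory.Limits NumberField IntermediateField

namespace Literature.AlgebraicGeometry.ComplexMultiplication.LinearlyDisjointCMFieldsHodge

open Literature.AlgebraicGeometry.ComplexMultiplication.IndependentCMFields

open Literature.NumberTheory.ComplexMultiplication
open Literature.AlgebraicGeometry.Motives (AbelianVariety CMType)
open Literature.AlgebraicGeometry.HodgeTheory
open Literature.AlgebraicGeometry.ComplexMultiplication (IsCMTypeRealisation)
open Literature.AlgebraicGeometry.VanGeemen1994 (hodgeClassSpan)
open Literature.AlgebraicGeometry.Pohlmann1968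
open Literature.Barriers.HodgeConjecture (divisorClassesSpan)

section Rank

variable {I : Type} {K : I → Type} [∀ i, Field (K i)] [∀ i, NumberField (K i)] [∀ i, IsCMField (K i)] [Fintype I]
  [Nonempty I]

/-- **Additivity of the rank for CM fields with linearly disjoint Galois closures**:
`cmFamilyRank Φ + |I| = Σ_i cmTypeRank Φ_i + 1`, i.e. `rank Hg(∏_i A_{Φ_i}) = Σ_i rank Hg(A_{Φ_i})` (Gordon §3 Theorem (1)
"`Hg(A) = Hg(E_1) × ⋯ × Hg(E_r)`" for fields that do not interact). [cite: Gordon1999HodgeAVSurvey, §3 Theorem (1)] -/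
theorem cmFamilyRank_add_card_eq_of_linearDisjoint
    (hdisj : ∀ i : I, (normalClosure ℚ (K i) ℂ).LinearDisjoint
      ↥(⨆ j : {j : I // j ≠ i}, normalClosure ℚ (K j.1) ℂ))
    (Φ : ∀ i, CMType (K i)) : CMAlgebra.cmFamilyRank Φ + Fintype.card I = (∑ i, cmTypeRank (Φ i)) + 1 :=
  cmFamilyRank_add_card_eq (slotwiseIndependent_of_linearDisjoint_normalClosure hdisj) Φ

/-- **For CM fields with linearly disjoint Galois closures a family of CM types is nondegenerate iff every member is**
(`∏_i A_{Φ_i}` stably nondegenerate ⟺ every `A_{Φ_i}` stably nondegenerate). [cite: Gordon1999HodgeAVSurvey, §3 Theorem and 7.5] -/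
theorem isNondegenerateFamily_iff_of_linearDisjoint
    (hdisj : ∀ i : I, (normalClosure ℚ (K i) ℂ).LinearDisjoint
      ↥(⨆ j : {j : I // j ≠ i}, normalClosure ℚ (K j.1) ℂ))
    (Φ : ∀ i, CMType (K i)) : CMAlgebra.IsNondegenerateFamily Φ ↔ ∀ i, IsNondegenerate (Φ i) :=
  isNondegenerateFamily_iff_forall_isNondegenerate (slotwiseIndependent_of_linearDisjoint_normalClosure hdisj) Φ

/-- **Galois form**: if `L_i ∩ ∏_{j≠i} L_j = ℚ` for every `i` (`L_i` the Galois closure of `K_i` in `ℂ`), a family of CM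
types of the `K_i` is nondegenerate iff every member is. [cite: Gordon1999HodgeAVSurvey, §3 Theorem and 7.5]
[cite: Lang2002, VI §1 Thm. 1.14] -/
theorem isNondegenerateFamily_iff_of_normalClosure_inf_eq_bot
    (hinf : ∀ i : I, normalClosure ℚ (K i) ℂ ⊓ (⨆ j : {j : I // j ≠ i}, normalClosure ℚ (K j.1) ℂ) = ⊥)
    (Φ : ∀ i, CMType (K i)) : CMAlgebra.IsNondegenerateFamily Φ ↔ ∀ i, IsNondegenerate (Φ i) :=
  isNondegenerateFamily_iff_forall_isNondegenerate (slotwiseIndependent_of_normalClosure_inf_eq_bot hinf) Φ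

end Rank

/-! ### Hodge classes on products of CM abelian varieties whose CM fields have linearly disjoint Galois closures -/

section Geometry

variable {I : Type} {K : I → Type} [∀ i, Field (K i)] [∀ i, NumberField (K i)] [∀ i, IsCMField (K i)] [Fintype I]
  [Nonempty I] {Φ : ∀ i, CMType (K i)}
variable {A : I → AbelianVariety ℂ} {ι : ∀ i, 𝓞 (K i) →+* End (A i)}
  {θ : ∀ i, K i →+* Module.End ℂ (complexBetti (A i).X 1)}

/-- **`Bᵐ ⊗ ℂ = Dᵐ ⊗ ℂ` on every product `⨁_{j<N} A_{π j}` (every `∏_i A_i^{k_i}`) of realisations of nondegenerate CM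
types of CM fields with linearly disjoint Galois closures** — such products are stably nondegenerate (Gordon §3 Theorem (2)
"`Hdg(A) = … = Div(A)`" beyond elliptic curves). [cite: Gordon1999HodgeAVSurvey, §3 Theorem (2) and 7.5] -/
theorem hodgeClassSpan_prod_eq_divisorClassesSpan_of_linearDisjoint
    (hdisj : ∀ i : I, (normalClosure ℚ (K i) ℂ).LinearDisjoint
      ↥(⨆ j : {j : I // j ≠ i}, normalClosure ℚ (K j.1) ℂ))
    (hΦ : ∀ i, IsNondegenerate (Φ i)) (hA : ∀ i, IsCMTypeRealisation (Φ i) (A i) (ι i) (θ i)) {N : ℕ}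
    (π : Fin N → I) (m : ℕ) :
    hodgeClassSpan (⨁ fun j : Fin N => A (π j)).dim (⨁ fun j : Fin N => A (π j)).X m =
      divisorClassesSpan (⨁ fun j : Fin N => A (π j)).X (⨁ fun j : Fin N => A (π j)).dim m :=
  hodgeClassSpan_prod_eq_divisorClassesSpan_of_slotwiseIndependent
    (slotwiseIndependent_of_linearDisjoint_normalClosure hdisj) hΦ hA π m

/-- **No product `⨁_{j<N} A_{π j}` of realisations of nondegenerate CM types of CM fields with linearly disjoint Galois
closures supports an exotic Hodge class.** [cite: Gordon1999HodgeAVSurvey, §3 Theorem (2) and 7.5] -/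
theorem not_exists_exceptional_prod_of_linearDisjoint
    (hdisj : ∀ i : I, (normalClosure ℚ (K i) ℂ).LinearDisjoint
      ↥(⨆ j : {j : I // j ≠ i}, normalClosure ℚ (K j.1) ℂ))
    (hΦ : ∀ i, IsNondegenerate (Φ i)) (hA : ∀ i, IsCMTypeRealisation (Φ i) (A i) (ι i) (θ i)) {N : ℕ}
    (π : Fin N → I) (m : ℕ) :
    ¬∃ c : complexBetti (⨁ fun j : Fin N => A (π j)).X (2 * m), IsRationalClass c ∧
        IsOfHodgeType (⨁ fun j : Fin N => A (π j)).dim (⨁ fun j : Fin N => A (π j)).X (2 * m) m m c ∧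
        c ∉ divisorClassesSpan (⨁ fun j : Fin N => A (π j)).X (⨁ fun j : Fin N => A (π j)).dim m :=
  not_exists_exceptional_prod_of_slotwiseIndependent (slotwiseIndependent_of_linearDisjoint_normalClosure hdisj) hΦ hA π m

/-- **The Hodge conjecture for every product `⨁_{j<N} A_{π j}` (every `∏_i A_i^{k_i}`) of realisations of NONDEGENERATE
CM types `(K_i; Φ_i)` of CM fields whose Galois closures are LINEARLY DISJOINT**, UNCONDITIONAL (no named fact): the
Galois closure `L_i` of each `K_i` in `ℂ` linearly disjoint over `ℚ` from the compositum of the others ⟹ the `Aut(ℂ)`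
actions on the `Hom(K_i, ℂ)` are independent ⟹ the product is stably nondegenerate ⟹ every Hodge class on it is a
polynomial in divisor classes (Lefschetz (1,1)). [cite: Gordon1999HodgeAVSurvey, §3 Theorem and 10.10] -/
theorem hodgeConjectureFor_prod_of_linearDisjoint
    (hdisj : ∀ i : I, (normalClosure ℚ (K i) ℂ).LinearDisjoint
      ↥(⨆ j : {j : I // j ≠ i}, normalClosure ℚ (K j.1) ℂ))
    (hΦ : ∀ i, IsNondegenerate (Φ i)) (hA : ∀ i, IsCMTypeRealisation (Φ i) (A i) (ι i) (θ i)) {N : ℕ}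
    (π : Fin N → I) : HodgeConjectureFor (⨁ fun j : Fin N => A (π j)).dim (⨁ fun j : Fin N => A (π j)).X :=
  hodgeConjectureFor_prod_of_slotwiseIndependent (slotwiseIndependent_of_linearDisjoint_normalClosure hdisj) hΦ hA π

/-- **Galois form of the same**: it suffices that `L_i ∩ ∏_{j≠i} L_j = ℚ` for every `i`, `L_i` the Galois closure of
`K_i` in `ℂ` — e.g. pairwise non-isogenous CM elliptic curves `E_i` with DISTINCT imaginary quadratic fields `K_i = L_i`
and `K_i ∩ ∏_{j≠i} K_j = ℚ` (Imai–Murty), or CM fields with pairwise coprime discriminants of their Galois closures.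
[cite: Gordon1999HodgeAVSurvey, §3 Theorem and 10.10] [cite: Lang2002, VI §1 Thm. 1.14] -/
theorem hodgeConjectureFor_prod_of_normalClosure_inf_eq_bot
    (hinf : ∀ i : I, normalClosure ℚ (K i) ℂ ⊓ (⨆ j : {j : I // j ≠ i}, normalClosure ℚ (K j.1) ℂ) = ⊥)
    (hΦ : ∀ i, IsNondegenerate (Φ i)) (hA : ∀ i, IsCMTypeRealisation (Φ i) (A i) (ι i) (θ i)) {N : ℕ}
    (π : Fin N → I) : HodgeConjectureFor (⨁ fun j : Fin N => A (π j)).dim (⨁ fun j : Fin N => A (π j)).X :=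
  hodgeConjectureFor_prod_of_slotwiseIndependent (slotwiseIndependent_of_normalClosure_inf_eq_bot hinf) hΦ hA π

/-- **Degree form of the same**: it suffices that `[L_i M_i : ℚ] = [L_i : ℚ] [M_i : ℚ]` for every `i`
(`M_i = ∏_{j≠i} L_j`). [cite: Gordon1999HodgeAVSurvey, §3 Theorem and 10.10] [cite: Lang2002, VIII §3] -/
theorem hodgeConjectureFor_prod_of_finrank_normalClosure_sup
    (hdeg : ∀ i : I, Module.finrank ℚ
        ↥(normalClosure ℚ (K i) ℂ ⊔ ⨆ j : {j : I // j ≠ i}, normalClosure ℚ (K j.1) ℂ) =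
      Module.finrank ℚ (normalClosure ℚ (K i) ℂ) *
        Module.finrank ℚ ↥(⨆ j : {j : I // j ≠ i}, normalClosure ℚ (K j.1) ℂ))
    (hΦ : ∀ i, IsNondegenerate (Φ i)) (hA : ∀ i, IsCMTypeRealisation (Φ i) (A i) (ι i) (θ i)) {N : ℕ}
    (π : Fin N → I) : HodgeConjectureFor (⨁ fun j : Fin N => A (π j)).dim (⨁ fun j : Fin N => A (π j)).X :=
  hodgeConjectureFor_prod_of_slotwiseIndependent (slotwiseIndependent_of_finrank_normalClosure_sup hdeg) hΦ hA π

end Geometry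

/-! ### The symmetric family form: `[∏_i L_i : ℚ] = ∏_i [L_i : ℚ]` (appended 2026-08-21, same seat) -/

section Family

variable {I : Type} {K : I → Type} [∀ i, Field (K i)] [∀ i, NumberField (K i)] [∀ i, IsCMField (K i)] [Fintype I]
  [Nonempty I] {Φ : ∀ i, CMType (K i)}
variable {A : I → AbelianVariety ℂ} {ι : ∀ i, 𝓞 (K i) →+* End (A i)}
  {θ : ∀ i, K i →+* Module.End ℂ (complexBetti (A i).X 1)}

/-- **Family form, rank side**: if the Galois closures `L_i = normalClosure ℚ K_i ℂ` have multiplicative degrees,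
`[⨆_i L_i : ℚ] = ∏_i [L_i : ℚ]`, then a family of CM types of the `K_i` is nondegenerate iff every member is.
[cite: Gordon1999HodgeAVSurvey, §3 Theorem and 7.5] [cite: Lang2002, VI §1 Thm. 1.14] -/
theorem isNondegenerateFamily_iff_of_finrank_iSup_normalClosure_eq_prod
    (h : Module.finrank ℚ ↥(⨆ i, normalClosure ℚ (K i) ℂ) = ∏ i, Module.finrank ℚ (normalClosure ℚ (K i) ℂ))
    (Ψ : ∀ i, CMType (K i)) : CMAlgebra.IsNondegenerateFamily Ψ ↔ ∀ i, IsNondegenerate (Ψ i) :=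
  isNondegenerateFamily_iff_forall_isNondegenerate (slotwiseIndependent_of_finrank_iSup_normalClosure_eq_prod h) Ψ

/-- **Family form, `B = D`**: under `[⨆_i L_i : ℚ] = ∏_i [L_i : ℚ]`, every product `⨁_{j<N} A_{π j}` of realisations of
nondegenerate CM types of the `K_i` has `Bᵐ ⊗ ℂ = Dᵐ ⊗ ℂ`. [cite: Gordon1999HodgeAVSurvey, §3 Theorem (2) and 7.5] -/
theorem hodgeClassSpan_prod_eq_divisorClassesSpan_of_finrank_iSup_normalClosure_eq_prod
    (h : Module.finrank ℚ ↥(⨆ i, normalClosure ℚ (K i) ℂ) = ∏ i, Module.finrank ℚ (normalClosure ℚ (K i) ℂ))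
    (hΦ : ∀ i, IsNondegenerate (Φ i)) (hA : ∀ i, IsCMTypeRealisation (Φ i) (A i) (ι i) (θ i)) {N : ℕ}
    (π : Fin N → I) (m : ℕ) :
    hodgeClassSpan (⨁ fun j : Fin N => A (π j)).dim (⨁ fun j : Fin N => A (π j)).X m =
      divisorClassesSpan (⨁ fun j : Fin N => A (π j)).X (⨁ fun j : Fin N => A (π j)).dim m :=
  hodgeClassSpan_prod_eq_divisorClassesSpan_of_slotwiseIndependent
    (slotwiseIndependent_of_finrank_iSup_normalClosure_eq_prod h) hΦ hA π m

/-- **The Hodge conjecture for every product `∏_i A_i^{k_i}` of realisations of nondegenerate CM types of CM fields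
whose Galois closures form a LINEARLY DISJOINT FAMILY** — `[∏_i L_i : ℚ] = ∏_i [L_i : ℚ]`, i.e.
`Gal(∏_i L_i / ℚ) = ∏_i Gal(L_i / ℚ)` — UNCONDITIONAL. [cite: Gordon1999HodgeAVSurvey, §3 Theorem and 10.10]
[cite: Lang2002, VI §1 Thm. 1.14] -/
theorem hodgeConjectureFor_prod_of_finrank_iSup_normalClosure_eq_prod
    (h : Module.finrank ℚ ↥(⨆ i, normalClosure ℚ (K i) ℂ) = ∏ i, Module.finrank ℚ (normalClosure ℚ (K i) ℂ))
    (hΦ : ∀ i, IsNondegenerate (Φ i)) (hA : ∀ i, IsCMTypeRealisation (Φ i) (A i) (ι i) (θ i)) {N : ℕ}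
    (π : Fin N → I) : HodgeConjectureFor (⨁ fun j : Fin N => A (π j)).dim (⨁ fun j : Fin N => A (π j)).X :=
  hodgeConjectureFor_prod_of_slotwiseIndependent (slotwiseIndependent_of_finrank_iSup_normalClosure_eq_prod h) hΦ hA π

end Family

end Literature.AlgebraicGeometry.ComplexMultiplication.LinearlyDisjointCMFieldsHodge

end
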